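import Mathlib.Analysis.Complex.CauchyIntegral
import Mathlib.Analysis.SpecialFunctions.PolarCoord
import Mathlib.Analysis.SpecialFunctions.Integrals.Basic
import Mathlib.Analysis.Calculus.FDeriv.Measurable
import Mathlib.Analysis.Calculus.ContDiff.Deriv
import Mathlib.Analysis.InnerProductSpace.Calculus
import Mathlib.MeasureTheory.Function.Jacobian
import Mathlib.MeasureTheory.Integral.MeanInequalities
import Mathlib.MeasureTheory.Group.Measure
import Mathlib.MeasureTheory.Group.LIntegral
import Mathlib.MeasureTheory.Measure.Haar.Unique
import Literature.Analysis.Complex.AnnulusCrossing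
import HarnessLib

/-!
# A fan of rays crossing an annulus under a conformal map: the length–area inequality for rays

Topic: complex analysis (the length–area method behind extremal length); companion of
`AnnulusCrossing.lean` (concentric semicircles). Everything here is proved.

Let `Ω ⊆ ℂ` be open, `F` holomorphic and injective on `Ω`, `0 < R₁ < R₂`, `0 < r₁ < r₂`, and
let `T ⊆ (-π, π)` be a measurable set of directions such that for every `θ ∈ T` the radial
segment `{a + r e^{iθ} : r₁ < r < r₂}` from the apex `a` lies in `Ω` and is mapped by `F` onto a
curve having a point of modulus `< R₁` and a point of modulus `> R₂` ("the ray crosses the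
annulus `{R₁ < |z| < R₂}`"). Then (`Literature.Analysis.Complex.FanCrossing.volume_mul_log_le_of_forall_crossing`)

  `|T| · log (R₂/R₁) ≤ 2π · log (r₂/r₁)`:

**a conformal map can make a fan of rays of angular width `|T|` and radial range `[r₁, r₂]` all
cross an annulus of modulus `log (R₂/R₁)` only if `log (R₂/R₁) ≤ 2π log (r₂/r₁) / |T|`.** This is
the comparison "extremal distance of the annulus boundaries ≤ extremal length of the fan
`≤ log (r₂/r₁)/|T|`" of the length–area method (Ahlfors (1973), Ch. 4, Thm. 4-1 and §4-2: the
extremal length of the family of radial segments of the sector `{r₁ < |z - a| < r₂, arg ∈ T}` is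
`log (r₂/r₁)/|T|`, by integrating the `ρ`-lengths of the rays, Fubini in polar coordinates and
Cauchy–Schwarz — exactly the computation below, with the pulled-back logarithmic metric
`ρ = |F'|/|F| · 1{R₁ < |F| < R₂}` of Pommerenke (1992), proof of Prop. 2.2), written, as in
`AnnulusCrossing.lean`, for the one explicit metric and family that are needed, so that no
general theory of extremal length is invoked:

* `ofReal_log_le_radLen` — a ray whose image crosses the annulus has `ρ`-length `≥ log (R₂/R₁)`
  (fundamental theorem of calculus for `log |F(a + r e^{iθ})|` on a crossing sub-segment);
* `radLen_sq_le` — Cauchy–Schwarz along a ray: `(∫ ρ dr)² ≤ log (r₂/r₁) ∫ ρ² r dr`;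
* `lintegral_densSq_le` — the `ρ²`-area of `Ω` is at most `2π log (R₂/R₁)` (area formula for the
  injective differentiable `F`, Mathlib's `lintegral_image_eq_lintegral_abs_det_fderiv_mul`);
* `lintegral_radSq_le` — Fubini in polar coordinates about the apex: `∫_T ∫ ρ² r dr dθ ≤ ∬ ρ²`.

The form is the one used for Beurling-type estimates in Loewner coordinates (a point of `ℍ`
from which one side of the boundary is inaccessible within a large ball has small harmonic
measure of that side): there the fan lives in the strip `{0 < im < π}` (`Ω`), `F = f ∘ exp` and
the apex is a point of the lower boundary line.

## References

* L. V. Ahlfors, *Conformal Invariants*, McGraw-Hill (1973), Ch. 4, §§4-1–4-3 (Thm. 4-1,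
  Example of §4-2). [Ahlfors1973CI]
* Ch. Pommerenke, *Boundary Behaviour of Conformal Maps*, Springer (1992), Prop. 2.2 (the
  length–area argument with the logarithmic metric). [PommerenkeBBCM1992]
* J. B. Garnett, D. E. Marshall, *Harmonic Measure*, CUP (2005), §IV.3.
-/

noncomputable section

open Set Filter Metric Topology MeasureTheory Complex Real
open scoped ENNReal NNReal

namespace Literature.Analysis.Complex

namespace FanCrossing

open AnnulusCrossing (exists_Ioo_crossing exists_hasDerivAt_log_norm lintegral_inv_Ioo
  lintegral_annulus_inv_sq add_polarCoord_symm)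

/-! ### Rays from an apex -/

/-- The point at distance `r` from the apex `a` in the direction `θ` is `circleMap a r θ`; as a
function of `r` it has derivative `e^{iθ}`. [folklore] -/
theorem hasDerivAt_circleMap_radius (a : ℂ) (θ r : ℝ) :
    HasDerivAt (fun r : ℝ ↦ circleMap a r θ) (exp (θ * I)) r := by
  have h : HasDerivAt (fun r : ℝ ↦ (r : ℂ)) 1 r := Complex.ofRealCLM.hasDerivAt
  have h2 := (h.mul_const (exp (θ * I))).const_add a
  simpa [circleMap, one_mul] using h2

/-- `‖e^{iθ}‖ = 1`. [folklore] -/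
theorem norm_exp_ofReal_mul_I (θ : ℝ) : ‖exp (θ * I)‖ = 1 := by
  rw [Complex.norm_exp_ofReal_mul_I]

/-! ### The pulled-back logarithmic metric on `Ω` -/

variable {Ω : Set ℂ} {F : ℂ → ℂ} {R₁ R₂ : ℝ}

/-- The open set `{w ∈ Ω : R₁ < |F w| < R₂}` on which the pulled-back metric lives. [folklore] -/
def preAnn (Ω : Set ℂ) (F : ℂ → ℂ) (R₁ R₂ : ℝ) : Set ℂ :=
  {w ∈ Ω | R₁ < ‖F w‖ ∧ ‖F w‖ < R₂}

/-- `preAnn ⊆ Ω`. [folklore] -/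
theorem preAnn_subset (Ω : Set ℂ) (F : ℂ → ℂ) (R₁ R₂ : ℝ) : preAnn Ω F R₁ R₂ ⊆ Ω :=
  fun _ hw ↦ hw.1

/-- `preAnn` is open when `Ω` is open and `F` is continuous on `Ω`. [folklore] -/
theorem isOpen_preAnn (hΩ : IsOpen Ω) (hF : ContinuousOn F Ω) (R₁ R₂ : ℝ) :
    IsOpen (preAnn Ω F R₁ R₂) :=
  hF.norm.isOpen_inter_preimage hΩ (isOpen_Ioo (a := R₁) (b := R₂))

/-- `preAnn` is measurable. [folklore] -/
theorem measurableSet_preAnn (hΩ : IsOpen Ω) (hF : ContinuousOn F Ω) (R₁ R₂ : ℝ) :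
    MeasurableSet (preAnn Ω F R₁ R₂) :=
  (isOpen_preAnn hΩ hF R₁ R₂).measurableSet

/-- The pulled-back metric `ρ = |F'|/|F|` on `preAnn Ω F R₁ R₂`, zero elsewhere. [folklore] -/
def dens (Ω : Set ℂ) (F : ℂ → ℂ) (R₁ R₂ : ℝ) : ℂ → ℝ≥0∞ :=
  (preAnn Ω F R₁ R₂).indicator fun w ↦ ENNReal.ofReal (‖deriv F w‖ / ‖F w‖)

/-- The square `ρ²` of the pulled-back metric. [folklore] -/
def densSq (Ω : Set ℂ) (F : ℂ → ℂ) (R₁ R₂ : ℝ) : ℂ → ℝ≥0∞ :=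
  (preAnn Ω F R₁ R₂).indicator fun w ↦ ENNReal.ofReal ((‖deriv F w‖ / ‖F w‖) ^ 2)

/-- `dens ^ 2 = densSq` pointwise. [folklore] -/
theorem dens_sq (Ω : Set ℂ) (F : ℂ → ℂ) (R₁ R₂ : ℝ) (w : ℂ) :
    dens Ω F R₁ R₂ w ^ 2 = densSq Ω F R₁ R₂ w := by
  by_cases hw : w ∈ preAnn Ω F R₁ R₂
  · simp [dens, densSq, hw, ENNReal.ofReal_pow (div_nonneg (norm_nonneg _) (norm_nonneg _))]
  · simp [dens, densSq, hw]

/-- `dens` is measurable (`F` is only used on the open set `Ω`, where it is continuous). [folklore] -/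
theorem measurable_dens (hΩ : IsOpen Ω) (hF : ContinuousOn F Ω) (R₁ R₂ : ℝ) :
    Measurable (dens Ω F R₁ R₂) := by
  classical
  have hF0 : Measurable (Ω.piecewise F 0) :=
    hF.measurable_piecewise continuousOn_const hΩ.measurableSet
  have heq : dens Ω F R₁ R₂ = (preAnn Ω F R₁ R₂).indicator
      fun w ↦ ENNReal.ofReal (‖deriv F w‖ / ‖Ω.piecewise F 0 w‖) := by
    funext w
    by_cases hw : w ∈ preAnn Ω F R₁ R₂
    · rw [dens, indicator_of_mem hw, indicator_of_mem hw, piecewise_eq_of_mem _ _ _ hw.1]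
    · rw [dens, indicator_of_notMem hw, indicator_of_notMem hw]
  rw [heq]
  exact (((measurable_deriv F).norm.div hF0.norm).ennreal_ofReal).indicator
    (measurableSet_preAnn hΩ hF R₁ R₂)

/-- `densSq` is measurable. [folklore] -/
theorem measurable_densSq (hΩ : IsOpen Ω) (hF : ContinuousOn F Ω) (R₁ R₂ : ℝ) :
    Measurable (densSq Ω F R₁ R₂) := by
  have h : densSq Ω F R₁ R₂ = fun w ↦ dens Ω F R₁ R₂ w ^ 2 :=
    funext fun w ↦ (dens_sq Ω F R₁ R₂ w).symm
  rw [h]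
  exact (measurable_dens hΩ hF R₁ R₂).pow_const 2

/-- The `ρ`-length of the radial segment `{a + r e^{iθ} : r₁ < r < r₂}`. [folklore] -/
def radLen (Ω : Set ℂ) (F : ℂ → ℂ) (R₁ R₂ : ℝ) (a : ℂ) (θ r₁ r₂ : ℝ) : ℝ≥0∞ :=
  ∫⁻ r in Ioo r₁ r₂, dens Ω F R₁ R₂ (circleMap a r θ)

/-- `∫_{r₁}^{r₂} ρ(a + r e^{iθ})² r dr`. [folklore] -/
def radSq (Ω : Set ℂ) (F : ℂ → ℂ) (R₁ R₂ : ℝ) (a : ℂ) (θ r₁ r₂ : ℝ) : ℝ≥0∞ :=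
  ∫⁻ r in Ioo r₁ r₂, ENNReal.ofReal r * densSq Ω F R₁ R₂ (circleMap a r θ)

/-! ### Cauchy–Schwarz along a ray -/

/-- **Cauchy–Schwarz along a ray**: `(∫_{r₁}^{r₂} ρ dr)² ≤ log (r₂/r₁) · ∫_{r₁}^{r₂} ρ² r dr`
(write `ρ = (ρ √r) · (1/√r)`). [folklore] -/
theorem radLen_sq_le (hΩ : IsOpen Ω) (hF : ContinuousOn F Ω) (R₁ R₂ : ℝ) (a : ℂ) (θ : ℝ)
    {r₁ r₂ : ℝ} (hr₁ : 0 < r₁) (hr : r₁ ≤ r₂) :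
    radLen Ω F R₁ R₂ a θ r₁ r₂ ^ 2 ≤
      ENNReal.ofReal (Real.log (r₂ / r₁)) * radSq Ω F R₁ R₂ a θ r₁ r₂ := by
  set μ : Measure ℝ := volume.restrict (Ioo r₁ r₂) with hμ
  set ρ : ℝ → ℝ≥0∞ := fun r ↦ dens Ω F R₁ R₂ (circleMap a r θ) with hρ
  have hρm : Measurable ρ :=
    (measurable_dens hΩ hF R₁ R₂).comp (AnnulusCrossing.continuous_circleMap_left a θ).measurable
  set f : ℝ → ℝ≥0∞ := fun r ↦ ρ r * ENNReal.ofReal (Real.sqrt r) with hf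
  set g : ℝ → ℝ≥0∞ := fun r ↦ ENNReal.ofReal (Real.sqrt r)⁻¹ with hg
  have hfm : AEMeasurable f μ := (hρm.mul Real.continuous_sqrt.measurable.ennreal_ofReal).aemeasurable
  have hgm : AEMeasurable g μ := (Real.continuous_sqrt.measurable.inv.ennreal_ofReal).aemeasurable
  have hcs := ENNReal.lintegral_mul_le_Lp_mul_Lq μ Real.HolderConjugate.two_two hfm hgm
  -- `f g = ρ` on `(r₁, r₂)`
  have hfg : ∫⁻ r, (f * g) r ∂μ = radLen Ω F R₁ R₂ a θ r₁ r₂ := by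
    rw [radLen, hμ]
    refine setLIntegral_congr_fun measurableSet_Ioo fun r hr ↦ ?_
    have hr0 : 0 < r := hr₁.trans hr.1
    have hs : 0 < Real.sqrt r := Real.sqrt_pos.2 hr0
    simp only [Pi.mul_apply, hf, hg, hρ]
    rw [mul_assoc, ← ENNReal.ofReal_mul hs.le, mul_inv_cancel₀ hs.ne', ENNReal.ofReal_one, mul_one]
  -- `∫ f² = ∫ ρ² r`
  have hf2 : ∫⁻ r, f r ^ (2 : ℝ) ∂μ = radSq Ω F R₁ R₂ a θ r₁ r₂ := by
    rw [radSq, hμ]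
    refine setLIntegral_congr_fun measurableSet_Ioo fun r hr ↦ ?_
    have hr0 : 0 < r := hr₁.trans hr.1
    simp only [hf, hρ, ENNReal.rpow_two, mul_pow, dens_sq]
    rw [← ENNReal.ofReal_pow (Real.sqrt_nonneg _), Real.sq_sqrt hr0.le, mul_comm]
  -- `∫ g² = log (r₂/r₁)`
  have hg2 : ∫⁻ r, g r ^ (2 : ℝ) ∂μ = ENNReal.ofReal (Real.log (r₂ / r₁)) := by
    rw [hμ, ← lintegral_inv_Ioo hr₁ hr]
    refine setLIntegral_congr_fun measurableSet_Ioo fun r hr ↦ ?_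
    have hr0 : 0 < r := hr₁.trans hr.1
    simp only [hg, ENNReal.rpow_two]
    rw [← ENNReal.ofReal_pow (inv_nonneg.2 (Real.sqrt_nonneg _)), inv_pow, Real.sq_sqrt hr0.le]
  rw [hfg, hf2, hg2] at hcs
  calc radLen Ω F R₁ R₂ a θ r₁ r₂ ^ 2
      ≤ (radSq Ω F R₁ R₂ a θ r₁ r₂ ^ (1 / 2 : ℝ) *
          ENNReal.ofReal (Real.log (r₂ / r₁)) ^ (1 / 2 : ℝ)) ^ 2 := by gcongr
    _ = ENNReal.ofReal (Real.log (r₂ / r₁)) * radSq Ω F R₁ R₂ a θ r₁ r₂ := by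
      rw [← ENNReal.mul_rpow_of_nonneg _ _ (by norm_num : (0 : ℝ) ≤ 1 / 2), ← ENNReal.rpow_two,
        ← ENNReal.rpow_mul]
      norm_num [mul_comm]

/-! ### A crossing ray has `ρ`-length at least `log (R₂ / R₁)` -/

/-- **A ray whose image crosses the annulus has `ρ`-length at least `log (R₂/R₁)`**: if `F` is
holomorphic on the open set `Ω`, the radial segment `{a + r e^{iθ} : r₁ < r < r₂}` lies in `Ω`,
and its image has a point of modulus `< R₁` and a point of modulus `> R₂`, then
`log (R₂/R₁) ≤ ∫_{r₁}^{r₂} ρ(a + r e^{iθ}) dr` for `ρ = |F'|/|F| · 1{R₁ < |F| < R₂}`. [folklore] -/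
theorem ofReal_log_le_radLen (hΩ : IsOpen Ω) (hF : DifferentiableOn ℂ F Ω) {a : ℂ} {θ r₁ r₂ : ℝ}
    (hseg : ∀ r ∈ Ioo r₁ r₂, circleMap a r θ ∈ Ω) (hR₁ : 0 < R₁) (hR : R₁ < R₂)
    {r' r'' : ℝ} (hr' : r' ∈ Ioo r₁ r₂) (hr'' : r'' ∈ Ioo r₁ r₂)
    (h₁ : ‖F (circleMap a r' θ)‖ < R₁) (h₂ : R₂ < ‖F (circleMap a r'' θ)‖) :
    ENNReal.ofReal (Real.log (R₂ / R₁)) ≤ radLen Ω F R₁ R₂ a θ r₁ r₂ := by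
  -- the curve and its derivative
  set G : ℝ → ℂ := fun r ↦ F (circleMap a r θ) with hGdef
  set G' : ℝ → ℂ := fun r ↦ deriv F (circleMap a r θ) * exp (θ * I) with hG'def
  have hGd : ∀ r ∈ Ioo r₁ r₂, HasDerivAt G (G' r) r := fun r hr ↦ by
    have hfd : HasDerivAt F (deriv F (circleMap a r θ)) (circleMap a r θ) :=
      (hF.differentiableAt (hΩ.mem_nhds (hseg r hr))).hasDerivAt
    exact hfd.comp r (hasDerivAt_circleMap_radius a θ r)
  have hIsub0 : Icc (min r' r'') (max r' r'') ⊆ Ioo r₁ r₂ := fun r hr ↦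
    ⟨(lt_min hr'.1 hr''.1).trans_le hr.1, hr.2.trans_lt (max_lt hr'.2 hr''.2)⟩
  have hGc : ContinuousOn G (Icc (min r' r'') (max r' r'')) := fun r hr ↦
    (hGd r (hIsub0 hr)).continuousAt.continuousWithinAt
  -- the crossing sub-segment
  obtain ⟨α, β, hα, hαβ, hβ, hin, hends⟩ := exists_Ioo_crossing (φ := fun r ↦ ‖G r‖) hGc.norm
    (s := r') (t := r'') ⟨min_le_left _ _, le_max_left _ _⟩ ⟨min_le_right _ _, le_max_right _ _⟩
    h₁ h₂ hR
  have hIsub : Icc α β ⊆ Ioo r₁ r₂ := fun r hr ↦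
    hIsub0 ⟨hα.trans hr.1, hr.2.trans hβ⟩
  have hbounds : ∀ r ∈ Icc α β, R₁ ≤ ‖G r‖ ∧ ‖G r‖ ≤ R₂ := fun r hr ↦ by
    rcases eq_or_lt_of_le hr.1 with h | h
    · subst h
      rcases hends with ⟨h1, -⟩ | ⟨h1, -⟩ <;> rw [h1] <;> constructor <;> linarith
    rcases eq_or_lt_of_le hr.2 with h' | h'
    · subst h'
      rcases hends with ⟨-, h1⟩ | ⟨-, h1⟩ <;> rw [h1] <;> constructor <;> linarith
    exact ⟨(hin r ⟨h, h'⟩).1.le, (hin r ⟨h, h'⟩).2.le⟩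
  have hG0 : ∀ r ∈ Icc α β, G r ≠ 0 := fun r hr ↦
    norm_pos_iff.1 (hR₁.trans_le (hbounds r hr).1)
  have hD : ∀ r ∈ Icc α β, ∃ d : ℝ, HasDerivAt (fun r ↦ Real.log ‖G r‖) d r ∧
      |d| ≤ ‖G' r‖ / ‖G r‖ := fun r hr ↦
    exists_hasDerivAt_log_norm (hGd r (hIsub hr)) (hG0 r hr)
  choose! d hd hdle using hD
  -- continuity of `G`, `G'`, and of `g = ‖G'‖/‖G‖` where `G ≠ 0`
  have hderivc : ContinuousOn (deriv F) Ω :=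
    (hF.contDiffOn hΩ).continuousOn_deriv_of_isOpen hΩ le_rfl
  have hGcI : ContinuousOn G (Ioo r₁ r₂) := fun r hr ↦ (hGd r hr).continuousAt.continuousWithinAt
  have hG'cI : ContinuousOn G' (Ioo r₁ r₂) := by
    refine ContinuousOn.mul ?_ continuousOn_const
    exact hderivc.comp (AnnulusCrossing.continuous_circleMap_left a θ).continuousOn fun r hr ↦ hseg r hr
  set U : Set ℝ := {r ∈ Ioo r₁ r₂ | G r ≠ 0} with hUdef
  have hUopen : IsOpen U := by
    rw [show U = Ioo r₁ r₂ ∩ G ⁻¹' {0}ᶜ by rfl]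
    exact hGcI.isOpen_inter_preimage isOpen_Ioo isOpen_compl_singleton
  have hIU : Icc α β ⊆ U := fun r hr ↦ ⟨hIsub hr, hG0 r hr⟩
  set g : ℝ → ℝ := fun r ↦ ‖G' r‖ / ‖G r‖ with hgdef
  have hgU : ContinuousOn g U :=
    (hG'cI.mono fun r hr ↦ hr.1).norm.div (hGcI.mono fun r hr ↦ hr.1).norm
      fun r hr ↦ norm_ne_zero_iff.2 hr.2
  have hgc : ContinuousOn g (Icc α β) := hgU.mono hIU
  have hg0 : ∀ r, 0 ≤ g r := fun r ↦ div_nonneg (norm_nonneg _) (norm_nonneg _)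
  have hgint : IntervalIntegrable g volume α β := hgc.intervalIntegrable_of_Icc hαβ.le
  have hprim : ∀ x ∈ Ioo α β, HasDerivAt (fun r ↦ ∫ t in α..r, g t) (g x) x := fun x hx ↦ by
    have hxU : x ∈ U := hIU (Ioo_subset_Icc_self hx)
    refine intervalIntegral.integral_hasDerivAt_right (hgint.mono_set ?_)
      (hgU.stronglyMeasurableAtFilter hUopen x hxU) (hgU.continuousAt (hUopen.mem_nhds hxU))
    rw [uIcc_of_le hαβ.le, uIcc_of_le hx.1.le]
    exact Icc_subset_Icc le_rfl hx.2.le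
  have hprimc : ContinuousOn (fun r ↦ ∫ t in α..r, g t) (Icc α β) := by
    have := intervalIntegral.continuousOn_primitive_interval' hgint (left_mem_uIcc (a := α) (b := β))
    rwa [uIcc_of_le hαβ.le] at this
  have hlogc : ContinuousOn (fun r ↦ Real.log ‖G r‖) (Icc α β) :=
    ((hGcI.mono hIsub).norm).log fun r hr ↦ norm_ne_zero_iff.2 (hG0 r hr)
  have hkey : ∀ σ : ℝ, (σ = 1 ∨ σ = -1) →
      σ * Real.log ‖G β‖ - σ * Real.log ‖G α‖ ≤ ∫ t in α..β, g t := by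
    intro σ hσ
    have hσ1 : |σ| = 1 := by rcases hσ with rfl | rfl <;> simp
    set H : ℝ → ℝ := fun r ↦ σ * Real.log ‖G r‖ - ∫ t in α..r, g t with hHdef
    have hHc : ContinuousOn H (Icc α β) := (hlogc.const_smul σ).sub hprimc
    have hHd : ∀ x ∈ Ioo α β, HasDerivAt H (σ * d x - g x) x := fun x hx ↦
      ((hd x (Ioo_subset_Icc_self hx)).const_mul σ).sub (hprim x hx)
    have hanti : AntitoneOn H (Icc α β) := by
      refine antitoneOn_of_deriv_nonpos (convex_Icc α β) hHc ?_ ?_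
      · rw [interior_Icc]
        exact fun x hx ↦ (hHd x hx).differentiableAt.differentiableWithinAt
      · rw [interior_Icc]
        intro x hx
        rw [(hHd x hx).deriv]
        have h1 : σ * d x ≤ |d x| := by
          have := abs_mul σ (d x)
          rw [hσ1, one_mul] at this
          exact (le_abs_self _).trans this.le
        have h2 := hdle x (Ioo_subset_Icc_self hx)
        simp only [hgdef]
        linarith
    have h := hanti (left_mem_Icc.2 hαβ.le) (right_mem_Icc.2 hαβ.le) hαβ.le
    simp only [hHdef, intervalIntegral.integral_same, sub_zero] at h
    linarith
  have hlog : Real.log (R₂ / R₁) ≤ ∫ t in α..β, g t := by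
    rw [Real.log_div (by linarith) hR₁.ne']
    rcases hends with ⟨h1, h2⟩ | ⟨h1, h2⟩
    · have := hkey 1 (Or.inl rfl)
      rw [h1, h2] at this
      linarith
    · have := hkey (-1) (Or.inr rfl)
      rw [h1, h2] at this
      linarith
  -- pass to the `ℝ≥0∞`-valued radial integral
  have hIoo : ∀ r ∈ Ioo α β, ENNReal.ofReal (g r) = dens Ω F R₁ R₂ (circleMap a r θ) := by
    intro r hr
    have hrI : r ∈ Ioo r₁ r₂ := hIsub (Ioo_subset_Icc_self hr)
    have hpre : circleMap a r θ ∈ preAnn Ω F R₁ R₂ := ⟨hseg r hrI, (hin r hr).1, (hin r hr).2⟩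
    have hg : g r = ‖deriv F (circleMap a r θ)‖ / ‖F (circleMap a r θ)‖ := by
      show ‖deriv F (circleMap a r θ) * exp (θ * I)‖ / ‖F (circleMap a r θ)‖ = _
      rw [norm_mul, norm_exp_ofReal_mul_I, mul_one]
    rw [dens, indicator_of_mem hpre, hg]
  calc ENNReal.ofReal (Real.log (R₂ / R₁))
      ≤ ENNReal.ofReal (∫ t in α..β, g t) := ENNReal.ofReal_le_ofReal hlog
    _ = ∫⁻ t in Ioc α β, ENNReal.ofReal (g t) := by
        rw [intervalIntegral.integral_of_le hαβ.le, ofReal_integral_eq_lintegral_ofReal]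
        · exact (hgc.integrableOn_Icc (μ := volume)).mono_set Ioc_subset_Icc_self
        · exact Eventually.of_forall fun r ↦ hg0 r
    _ = ∫⁻ t in Ioo α β, ENNReal.ofReal (g t) := setLIntegral_congr Ioo_ae_eq_Ioc.symm
    _ = ∫⁻ t in Ioo α β, dens Ω F R₁ R₂ (circleMap a t θ) :=
        setLIntegral_congr_fun measurableSet_Ioo hIoo
    _ ≤ radLen Ω F R₁ R₂ a θ r₁ r₂ :=
        lintegral_mono_set (Ioo_subset_Ioo (hIsub (left_mem_Icc.2 hαβ.le)).1.le
          (hIsub (right_mem_Icc.2 hαβ.le)).2.le)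

/-! ### The `ρ²`-area of `Ω` is at most the logarithmic area of the annulus -/

/-- **Area bound**: the `ρ²`-area of `Ω` is at most `2π log (R₂/R₁)` (area formula for the
injective differentiable map `F` on `{w ∈ Ω : R₁ < |F w| < R₂}`, Jacobian `|F'|²`, and the
logarithmic area of the annulus). [cite: PommerenkeBBCM1992, Prop. 2.2] -/
theorem lintegral_densSq_le (hΩ : IsOpen Ω) (hF : DifferentiableOn ℂ F Ω) (hinj : InjOn F Ω)
    (hR₁ : 0 < R₁) (hR : R₁ ≤ R₂) :
    ∫⁻ w, densSq Ω F R₁ R₂ w ≤ ENNReal.ofReal (2 * π) * ENNReal.ofReal (Real.log (R₂ / R₁)) := by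
  have hsub : preAnn Ω F R₁ R₂ ⊆ Ω := preAnn_subset Ω F R₁ R₂
  have hmeas : MeasurableSet (preAnn Ω F R₁ R₂) := measurableSet_preAnn hΩ hF.continuousOn R₁ R₂
  have hd : ∀ w ∈ preAnn Ω F R₁ R₂, HasFDerivWithinAt F
      ((ContinuousLinearMap.smulRight (1 : ℂ →L[ℂ] ℂ) (deriv F w)).restrictScalars ℝ)
      (preAnn Ω F R₁ R₂) w := fun w hw ↦
    ((hF.differentiableAt (hΩ.mem_nhds (hsub hw))).hasDerivAt.hasFDerivAt
      |>.restrictScalars ℝ).hasFDerivWithinAt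
  set G : ℂ → ℝ≥0∞ := fun z ↦ ENNReal.ofReal (‖z‖ ^ 2)⁻¹ with hG
  have hcv := lintegral_image_eq_lintegral_abs_det_fderiv_mul volume hmeas hd (hinj.mono hsub) G
  have hrhs : ∫⁻ w in preAnn Ω F R₁ R₂, ENNReal.ofReal |((ContinuousLinearMap.smulRight
      (1 : ℂ →L[ℂ] ℂ) (deriv F w)).restrictScalars ℝ).det| * G (F w) =
      ∫⁻ w, densSq Ω F R₁ R₂ w := by
    rw [densSq, lintegral_indicator hmeas]
    refine setLIntegral_congr_fun hmeas fun w hw ↦ ?_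
    rw [LengthArea.det_restrictScalars_smulRight, abs_of_nonneg (by positivity), hG,
      ← ENNReal.ofReal_mul (by positivity)]
    congr 1
    rw [div_pow, div_eq_mul_inv]
  rw [← hrhs, ← hcv, ← lintegral_annulus_inv_sq hR₁ hR]
  refine lintegral_mono_set ?_
  rintro _ ⟨w, hw, rfl⟩
  exact hw.2

/-! ### Fubini in polar coordinates about the apex -/

/-- `∫_{θ ∈ (-π, π)} ∫_{r > 0} r ρ(a + r e^{iθ})² dr dθ ≤ ∬ ρ²` (polar coordinates about the
apex `a`, angular integral outside). [folklore] -/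
theorem lintegral_lintegral_densSq_le (hΩ : IsOpen Ω) (hF : ContinuousOn F Ω) (R₁ R₂ : ℝ) (a : ℂ) :
    ∫⁻ θ in Ioo (-π) π, ∫⁻ r in Ioi (0 : ℝ), ENNReal.ofReal r * densSq Ω F R₁ R₂ (circleMap a r θ) ≤
      ∫⁻ w, densSq Ω F R₁ R₂ w := by
  have hG : Measurable fun q : ℝ × ℝ ↦ ENNReal.ofReal q.1 * densSq Ω F R₁ R₂ (circleMap a q.1 q.2) :=
    measurable_fst.ennreal_ofReal.mul
      ((measurable_densSq hΩ hF R₁ R₂).comp (AnnulusCrossing.continuous_circleMap_uncurry a).measurable)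
  rw [← lintegral_add_left_eq_self (μ := volume) (densSq Ω F R₁ R₂) a,
    ← Complex.lintegral_comp_polarCoord_symm]
  simp_rw [smul_eq_mul, add_polarCoord_symm]
  rw [show polarCoord.target = Ioi (0 : ℝ) ×ˢ Ioo (-π) π from rfl, Measure.volume_eq_prod,
    ← Measure.prod_restrict, lintegral_prod_symm _ hG.aemeasurable]

/-- `∫_{θ ∈ T} ∫_{r₁}^{r₂} r ρ² dr dθ ≤ ∬ ρ²` for `T ⊆ (-π, π)` and `0 ≤ r₁`. [folklore] -/
theorem lintegral_radSq_le (hΩ : IsOpen Ω) (hF : ContinuousOn F Ω) (R₁ R₂ : ℝ) (a : ℂ)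
    {T : Set ℝ} (hT : T ⊆ Ioo (-π) π) {r₁ r₂ : ℝ} (hr₁ : 0 ≤ r₁) :
    ∫⁻ θ in T, radSq Ω F R₁ R₂ a θ r₁ r₂ ≤ ∫⁻ w, densSq Ω F R₁ R₂ w := by
  refine le_trans ?_ (lintegral_lintegral_densSq_le hΩ hF R₁ R₂ a)
  calc ∫⁻ θ in T, radSq Ω F R₁ R₂ a θ r₁ r₂
      ≤ ∫⁻ θ in Ioo (-π) π, radSq Ω F R₁ R₂ a θ r₁ r₂ := lintegral_mono_set hT
    _ ≤ ∫⁻ θ in Ioo (-π) π, ∫⁻ r in Ioi (0 : ℝ),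
          ENNReal.ofReal r * densSq Ω F R₁ R₂ (circleMap a r θ) := by
        refine lintegral_mono fun θ ↦ ?_
        exact lintegral_mono_set fun r hr ↦ (hr₁.trans_lt hr.1 : (0 : ℝ) < r)

/-! ### The length–area inequality for a fan of rays -/

/-- **Length–area for a fan of rays crossing an annulus.** Let `Ω ⊆ ℂ` be open, `F` holomorphic
and injective on `Ω`, `0 < R₁ < R₂`, `0 < r₁ < r₂`, and let `T ⊆ (-π, π)` be a measurable set of
directions such that for every `θ ∈ T` the radial segment `{a + r e^{iθ} : r₁ < r < r₂}` lies in
`Ω` and its image under `F` has a point of modulus `< R₁` and a point of modulus `> R₂`. Then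
`|T| · log (R₂/R₁) ≤ 2π · log (r₂/r₁)`. (Each such ray has `ρ`-length `≥ L = log (R₂/R₁)`; by
Cauchy–Schwarz `L² ≤ log (r₂/r₁) ∫ ρ² r dr`; integrating over `θ ∈ T` and using polar coordinates
about `a`, `|T| L² ≤ log (r₂/r₁) ∬ ρ² ≤ 2π L log (r₂/r₁)`.) This is the comparison "extremal
distance of the annulus boundaries `≤` extremal length `log (r₂/r₁)/|T|` of the fan" of the
length–area method, Ahlfors (1973), Thm. 4-1 with the sector example of §4-2.
[cite: Ahlfors1973CI, Ch. 4, Thm. 4-1 and §4-2] -/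
theorem volume_mul_log_le_of_forall_crossing (hΩ : IsOpen Ω) (hF : DifferentiableOn ℂ F Ω)
    (hinj : InjOn F Ω) (hR₁ : 0 < R₁) (hR : R₁ < R₂) {a : ℂ} {r₁ r₂ : ℝ} (hr₁ : 0 < r₁)
    (hr : r₁ < r₂) {T : Set ℝ} (hTm : MeasurableSet T) (hT : T ⊆ Ioo (-π) π)
    (hseg : ∀ θ ∈ T, ∀ r ∈ Ioo r₁ r₂, circleMap a r θ ∈ Ω)
    (hcross : ∀ θ ∈ T, ∃ r' ∈ Ioo r₁ r₂, ∃ r'' ∈ Ioo r₁ r₂,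
      ‖F (circleMap a r' θ)‖ < R₁ ∧ R₂ < ‖F (circleMap a r'' θ)‖) :
    volume T * ENNReal.ofReal (Real.log (R₂ / R₁)) ≤
      ENNReal.ofReal (2 * π * Real.log (r₂ / r₁)) := by
  set L : ℝ := Real.log (R₂ / R₁) with hL
  set M : ℝ := Real.log (r₂ / r₁) with hM
  have hLpos : 0 < L := Real.log_pos ((one_lt_div hR₁).2 hR)
  have hMpos : 0 < M := Real.log_pos ((one_lt_div hr₁).2 hr)
  have hFc : ContinuousOn F Ω := hF.continuousOn
  -- pointwise in `θ`: `L² ≤ M ∫ ρ² r dr`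
  have hpt : ∀ θ ∈ T, ENNReal.ofReal (L ^ 2) ≤ ENNReal.ofReal M * radSq Ω F R₁ R₂ a θ r₁ r₂ := by
    intro θ hθ
    obtain ⟨r', hr', r'', hr'', h1, h2⟩ := hcross θ hθ
    have hlen := ofReal_log_le_radLen hΩ hF (hseg θ hθ) hR₁ hR hr' hr'' h1 h2
    calc ENNReal.ofReal (L ^ 2) = ENNReal.ofReal L ^ 2 := by
          rw [ENNReal.ofReal_pow hLpos.le]
      _ ≤ radLen Ω F R₁ R₂ a θ r₁ r₂ ^ 2 := by gcongr
      _ ≤ ENNReal.ofReal M * radSq Ω F R₁ R₂ a θ r₁ r₂ := radLen_sq_le hΩ hFc R₁ R₂ a θ hr₁ hr.le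
  -- integrate over `T`
  have hint : ENNReal.ofReal (L ^ 2) * volume T ≤
      ENNReal.ofReal M * (ENNReal.ofReal (2 * π) * ENNReal.ofReal L) := by
    calc ENNReal.ofReal (L ^ 2) * volume T
        = ∫⁻ _ in T, ENNReal.ofReal (L ^ 2) := by rw [setLIntegral_const]
      _ ≤ ∫⁻ θ in T, ENNReal.ofReal M * radSq Ω F R₁ R₂ a θ r₁ r₂ := setLIntegral_mono' hTm hpt
      _ = ENNReal.ofReal M * ∫⁻ θ in T, radSq Ω F R₁ R₂ a θ r₁ r₂ :=
          lintegral_const_mul' _ _ ENNReal.ofReal_ne_top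
      _ ≤ ENNReal.ofReal M * ∫⁻ w, densSq Ω F R₁ R₂ w :=
          mul_le_mul_right (lintegral_radSq_le hΩ hFc R₁ R₂ a hT hr₁.le) _
      _ ≤ ENNReal.ofReal M * (ENNReal.ofReal (2 * π) * ENNReal.ofReal L) :=
          mul_le_mul_right (lintegral_densSq_le hΩ hF hinj hR₁ hR.le) _
  -- divide by `L`
  have hvol : volume T ≠ ∞ := by
    refine (lt_of_le_of_lt (measure_mono hT) ?_).ne
    rw [Real.volume_Ioo]
    exact ENNReal.ofReal_lt_top
  have hL0 : ENNReal.ofReal L ≠ 0 := by positivity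
  have hLtop : ENNReal.ofReal L ≠ ∞ := ENNReal.ofReal_ne_top
  have h2 : ENNReal.ofReal (L ^ 2) = ENNReal.ofReal L * ENNReal.ofReal L := by
    rw [sq, ENNReal.ofReal_mul hLpos.le]
  rw [h2] at hint
  have h3 : ENNReal.ofReal L * (volume T * ENNReal.ofReal L) ≤
      ENNReal.ofReal L * (ENNReal.ofReal M * ENNReal.ofReal (2 * π)) := by
    calc ENNReal.ofReal L * (volume T * ENNReal.ofReal L)
        = ENNReal.ofReal L * ENNReal.ofReal L * volume T := by ring
      _ ≤ ENNReal.ofReal M * (ENNReal.ofReal (2 * π) * ENNReal.ofReal L) := hint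
      _ = ENNReal.ofReal L * (ENNReal.ofReal M * ENNReal.ofReal (2 * π)) := by ring
  have h4 : volume T * ENNReal.ofReal L ≤ ENNReal.ofReal M * ENNReal.ofReal (2 * π) :=
    (ENNReal.mul_le_mul_iff_right hL0 hLtop).1 h3
  calc volume T * ENNReal.ofReal L ≤ ENNReal.ofReal M * ENNReal.ofReal (2 * π) := h4
    _ = ENNReal.ofReal (2 * π * M) := by
        rw [← ENNReal.ofReal_mul hMpos.le, mul_comm]

/-- **Real-number form.** Under the hypotheses of `volume_mul_log_le_of_forall_crossing` with
`T = (θ₁, θ₂)`, `-π ≤ θ₁ < θ₂ ≤ π`: `(θ₂ - θ₁) log (R₂/R₁) ≤ 2π log (r₂/r₁)`.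
[cite: Ahlfors1973CI, Ch. 4, Thm. 4-1 and §4-2] -/
theorem sub_mul_log_le_of_forall_crossing (hΩ : IsOpen Ω) (hF : DifferentiableOn ℂ F Ω)
    (hinj : InjOn F Ω) (hR₁ : 0 < R₁) (hR : R₁ < R₂) {a : ℂ} {r₁ r₂ : ℝ} (hr₁ : 0 < r₁)
    (hr : r₁ < r₂) {θ₁ θ₂ : ℝ} (hθ₁ : -π ≤ θ₁) (hθ : θ₁ < θ₂) (hθ₂ : θ₂ ≤ π)
    (hseg : ∀ θ ∈ Ioo θ₁ θ₂, ∀ r ∈ Ioo r₁ r₂, circleMap a r θ ∈ Ω)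
    (hcross : ∀ θ ∈ Ioo θ₁ θ₂, ∃ r' ∈ Ioo r₁ r₂, ∃ r'' ∈ Ioo r₁ r₂,
      ‖F (circleMap a r' θ)‖ < R₁ ∧ R₂ < ‖F (circleMap a r'' θ)‖) :
    (θ₂ - θ₁) * Real.log (R₂ / R₁) ≤ 2 * π * Real.log (r₂ / r₁) := by
  have h := volume_mul_log_le_of_forall_crossing hΩ hF hinj hR₁ hR hr₁ hr measurableSet_Ioo
    (Ioo_subset_Ioo hθ₁ hθ₂) hseg hcross
  rw [Real.volume_Ioo, ← ENNReal.ofReal_mul (by linarith)] at h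
  have hM : 0 ≤ 2 * π * Real.log (r₂ / r₁) :=
    mul_nonneg (by positivity) (Real.log_nonneg ((one_le_div hr₁).2 hr.le))
  exact (ENNReal.ofReal_le_ofReal_iff hM).1 h

end FanCrossing

end Literature.Analysis.Complex

end
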